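import Mathlib
import HarnessLib

/-!
# Lieb's spin-reflection-positivity argument (matrix form of Theorem 1 of Lieb 1989)

Family `hubbard` (trunk T-QLATTICE). This file isolates the linear-algebra core of the proof of
Theorem 1(b) of E. H. Lieb, *Two theorems on the Hubbard model*, PRL 62 (1989) 1201: the
uniqueness of the ground state of the attractive Hubbard model in the `S^z = 0` sector, phrased
entirely in terms of the `m × m` coefficient matrix `W` of a state `ψ = Σ W_{αβ} ψ^α_↑ ⊗ ψ^β_↓`.
It uses Mathlib only (spectral theorem `Matrix.IsHermitian.spectral_theorem`, `Matrix.PosSemidef`,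
`Matrix.PosDef`, `Module.End.exists_eigenvalue`); the Fock-space side (the transfer
`ψ ↦ W`, the Hubbard matrices `K`, `L_x`, irreducibility from connectivity, and the `SU(2)`
bookkeeping reducing all sectors to `S^z = 0`) is in `HubbardLiebConfig` and
`HubbardWave0LiebProofs`, where `Literature.MathematicalPhysics.QuantumLattice.lieb_attractive` is discharged.

## Contents

* `liebOp K L U W = K W + W K + U Σ_x L_x W L_x` — Lieb's eq. (4); `hsInner Z W = tr (Zᴴ W)` — the
  Hilbert–Schmidt inner product (`⟨ψ|ψ⟩ = Tr W²`); linearity, `(𝓗 W)ᴴ = 𝓗 Wᴴ`, self-adjointness.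
* `liebOp_eq_smul_of_energy_le` — the variational principle: a minimiser of `Re ⟨W, 𝓗 W⟩ / ‖W‖²`
  solves (4).
* `unitConj V f = V diag(f) Vᴴ` and `re_trace_unitConj_mul_le` — Lieb's trace inequality
  `Tr W L W L ≤ Tr |W| L |W| L`; `IsLiebSystem.liebOp_unitConj_abs` — if `W` is a ground state so
  is `|W|` (spin-space reflection positivity).
* `IsLiebSystem K L U E` — the hypotheses (Hermitian `K`, `L_x`; `U < 0`; `E` = infimum of the
  quadratic form; irreducibility of `{K, L_x}`), and under them: `eq_zero_or_posDef` (a positive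
  semidefinite ground state is `0` or definite — the kernel argument), `trichotomy`
  (`W = ±|W|`), `exists_eq_real_smul`, `exists_posDef_eq_smul`, and the conclusions
  `IsLiebSystem.exists_eq_smul` (uniqueness up to scalars) and `IsLiebSystem.apply_self_ne_zero`
  (all diagonal entries of a ground state are nonzero).

## Deviations from the printed proof

Lieb allows site-dependent `U_x ≤ 0` (and `< 0` for uniqueness); here `U` is a constant, as in
`Literature.MathematicalPhysics.QuantumLattice.hamiltonian`. The step "there must be a `d` for which `W¹ + dW²` is neither positive
nor negative semidefinite" is realised as: take `d` an eigenvalue of `P⁻¹W` (`P` positive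
definite), then `W - dP` is a singular Hermitian ground state, hence `0` by the trichotomy.

## References

* E. H. Lieb, *Two theorems on the Hubbard model*, Phys. Rev. Lett. 62 (1989) 1201–1204;
  Erratum 62 (1989) 1927. Theorem 1 and its proof, eqs. (3), (4). [LiebPRL1989]
-/

namespace Literature.MathematicalPhysics.QuantumLattice

open Matrix Finset
open scoped ComplexOrder

section LiebMatrix

variable {A X : Type*} [Fintype A] [Fintype X]

/-- Lieb's reduced Hamiltonian acting on coefficient matrices,
`𝓗 W = K W + W K + U Σ_x L_x W L_x`: the eigenvalue equation `H ψ = e ψ` of the Hubbard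
Hamiltonian in the `S^z = 0` sector becomes `𝓗 W = e W` for `ψ = Σ W_{αβ} ψ^α_↑ ⊗ ψ^β_↓`.
Stated for an arbitrary Hermitian `K`, Hermitian family `L_x` and a constant coupling `U`
(`U_x ≡ U`, as in `Literature.MathematicalPhysics.QuantumLattice.hamiltonian`).
Lieb, PRL 62 (1989) 1201, eq. (4). [cite: LiebPRL1989, eq. (4)] -/
def liebOp (K : Matrix A A ℂ) (L : X → Matrix A A ℂ) (U : ℝ) (W : Matrix A A ℂ) :
    Matrix A A ℂ :=
  K * W + W * K + (U : ℂ) • ∑ x, L x * W * L x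

/-- The Hilbert–Schmidt (Frobenius) inner product `⟨Z, W⟩ = tr (Zᴴ W) = Σ conj(Z_{αβ}) W_{αβ}`;
for `Z = W` this is Lieb's `⟨ψ|ψ⟩ = Σ |W_{αβ}|² = Tr W²` (W Hermitian). Mathlib has the Frobenius
norm (`Matrix.frobenius_norm_def`) but no inner-product instance on matrices, hence this local
definition. Lieb, PRL 62 (1989) 1201, proof of Theorem 1. [cite: LiebPRL1989, proof of Theorem 1] -/
def hsInner (Z W : Matrix A A ℂ) : ℂ := (Zᴴ * W).trace

/-- `⟨Z, W⟩ = Σ_{a,b} conj(Z_{ab}) W_{ab}`. [folklore] -/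
theorem hsInner_apply (Z W : Matrix A A ℂ) :
    hsInner Z W = ∑ a, ∑ b, star (Z a b) * W a b := by
  rw [hsInner, Matrix.trace, Finset.sum_comm]
  simp [Matrix.mul_apply, conjTranspose_apply]

/-- `⟨Z, W₁ + W₂⟩ = ⟨Z, W₁⟩ + ⟨Z, W₂⟩`. [folklore] -/
theorem hsInner_add_right (Z W₁ W₂ : Matrix A A ℂ) :
    hsInner Z (W₁ + W₂) = hsInner Z W₁ + hsInner Z W₂ := by
  rw [hsInner, hsInner, hsInner, Matrix.mul_add, trace_add]

/-- `⟨Z, c W⟩ = c ⟨Z, W⟩`. [folklore] -/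
theorem hsInner_smul_right (Z W : Matrix A A ℂ) (c : ℂ) :
    hsInner Z (c • W) = c * hsInner Z W := by
  rw [hsInner, hsInner, Matrix.mul_smul, trace_smul, smul_eq_mul]

/-- `⟨Z, W₁ - W₂⟩ = ⟨Z, W₁⟩ - ⟨Z, W₂⟩`. [folklore] -/
theorem hsInner_sub_right (Z W₁ W₂ : Matrix A A ℂ) :
    hsInner Z (W₁ - W₂) = hsInner Z W₁ - hsInner Z W₂ := by
  rw [hsInner, hsInner, hsInner, Matrix.mul_sub, trace_sub]

/-- `⟨Z₁ + Z₂, W⟩ = ⟨Z₁, W⟩ + ⟨Z₂, W⟩`. [folklore] -/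
theorem hsInner_add_left (Z₁ Z₂ W : Matrix A A ℂ) :
    hsInner (Z₁ + Z₂) W = hsInner Z₁ W + hsInner Z₂ W := by
  rw [hsInner, hsInner, hsInner, conjTranspose_add, Matrix.add_mul, trace_add]

/-- `⟨c Z, W⟩ = conj(c) ⟨Z, W⟩`. [folklore] -/
theorem hsInner_smul_left (Z W : Matrix A A ℂ) (c : ℂ) :
    hsInner (c • Z) W = star c * hsInner Z W := by
  rw [hsInner, hsInner, conjTranspose_smul, Matrix.smul_mul, trace_smul, smul_eq_mul]

/-- `⟨Z₁ - Z₂, W⟩ = ⟨Z₁, W⟩ - ⟨Z₂, W⟩`. [folklore] -/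
theorem hsInner_sub_left (Z₁ Z₂ W : Matrix A A ℂ) :
    hsInner (Z₁ - Z₂) W = hsInner Z₁ W - hsInner Z₂ W := by
  rw [hsInner, hsInner, hsInner, conjTranspose_sub, Matrix.sub_mul, trace_sub]

/-- Conjugate symmetry `conj ⟨Z, W⟩ = ⟨W, Z⟩`. [folklore] -/
theorem star_hsInner (Z W : Matrix A A ℂ) : star (hsInner Z W) = hsInner W Z := by
  rw [hsInner, hsInner, ← trace_conjTranspose, conjTranspose_mul, conjTranspose_conjTranspose]

/-- `⟨W, W⟩ = Σ |W_{ab}|²` (Lieb: `⟨ψ|ψ⟩ = Σ |W_{αβ}|²`). Lieb, PRL 62 (1989) 1201, proof of Theorem 1. [cite: LiebPRL1989, proof of Theorem 1] -/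
theorem hsInner_self_eq (W : Matrix A A ℂ) :
    hsInner W W = ((∑ a, ∑ b, ‖W a b‖ ^ 2 : ℝ) : ℂ) := by
  rw [hsInner_apply]
  push_cast
  refine Finset.sum_congr rfl fun a _ => Finset.sum_congr rfl fun b _ => ?_
  rw [Complex.star_def, Complex.conj_mul']

/-- `Re ⟨W, W⟩ = Σ |W_{ab}|²`. [folklore] -/
theorem hsInner_self_re (W : Matrix A A ℂ) :
    (hsInner W W).re = ∑ a, ∑ b, ‖W a b‖ ^ 2 := by
  rw [hsInner_self_eq, Complex.ofReal_re]

/-- `0 ≤ Re ⟨W, W⟩`. [folklore] -/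
theorem hsInner_self_re_nonneg (W : Matrix A A ℂ) : 0 ≤ (hsInner W W).re := by
  rw [hsInner_self_re]
  exact Finset.sum_nonneg fun a _ => Finset.sum_nonneg fun b _ => sq_nonneg _

/-- `Re ⟨W, W⟩ = 0 ↔ W = 0`. [folklore] -/
theorem hsInner_self_re_eq_zero_iff (W : Matrix A A ℂ) : (hsInner W W).re = 0 ↔ W = 0 := by
  constructor
  · intro h
    rw [hsInner_self_re] at h
    ext a b
    have ha := (Finset.sum_eq_zero_iff_of_nonneg (fun a _ =>
      Finset.sum_nonneg fun b _ => sq_nonneg (‖W a b‖))).1 h a (mem_univ a)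
    have hb := (Finset.sum_eq_zero_iff_of_nonneg (fun b _ => sq_nonneg (‖W a b‖))).1 ha b
      (mem_univ b)
    simpa using hb
  · rintro rfl
    simp [hsInner]

/-! ### Linearity and symmetry of `liebOp` -/

variable (K : Matrix A A ℂ) (L : X → Matrix A A ℂ) (U : ℝ)

/-- `𝓗` is additive ("by linearity" of eq. (4)). Lieb, PRL 62 (1989) 1201, proof of Theorem 1. [cite: LiebPRL1989, eq. (4)] -/
theorem liebOp_add (W Z : Matrix A A ℂ) :
    liebOp K L U (W + Z) = liebOp K L U W + liebOp K L U Z := by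
  simp only [liebOp, Matrix.mul_add, Matrix.add_mul, Finset.sum_add_distrib, smul_add]
  abel

/-- `𝓗` is homogeneous. Lieb, PRL 62 (1989) 1201, eq. (4). [cite: LiebPRL1989, eq. (4)] -/
theorem liebOp_smul (c : ℂ) (W : Matrix A A ℂ) :
    liebOp K L U (c • W) = c • liebOp K L U W := by
  simp only [liebOp, Matrix.mul_smul, Matrix.smul_mul, ← Finset.smul_sum, smul_add,
    smul_comm (U : ℂ) c]

/-- `𝓗 0 = 0`. [folklore] -/
theorem liebOp_zero : liebOp K L U (0 : Matrix A A ℂ) = 0 := by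
  simp [liebOp]

/-- `𝓗 (-W) = -𝓗 W`. [folklore] -/
theorem liebOp_neg (W : Matrix A A ℂ) : liebOp K L U (-W) = -liebOp K L U W := by
  rw [← neg_one_smul ℂ W, liebOp_smul, neg_one_smul]

/-- `𝓗 (W - Z) = 𝓗 W - 𝓗 Z`. [folklore] -/
theorem liebOp_sub (W Z : Matrix A A ℂ) :
    liebOp K L U (W - Z) = liebOp K L U W - liebOp K L U Z := by
  rw [sub_eq_add_neg, liebOp_add, liebOp_neg, ← sub_eq_add_neg]

/-- `𝓗` as a `ℂ`-linear map on matrices. Lieb, PRL 62 (1989) 1201, eq. (4) ("by virtue of the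
linearity of the eigenvalue Eq. (4)"). [cite: LiebPRL1989, eq. (4)] -/
def liebOpLin : Matrix A A ℂ →ₗ[ℂ] Matrix A A ℂ where
  toFun := liebOp K L U
  map_add' := liebOp_add K L U
  map_smul' := liebOp_smul K L U

/-- Unfolding lemma for `liebOpLin`. [folklore] -/
@[simp] theorem liebOpLin_apply (W : Matrix A A ℂ) : liebOpLin K L U W = liebOp K L U W := rfl

variable {K L}

/-- `(𝓗 W)ᴴ = 𝓗 (Wᴴ)` for Hermitian `K`, `L_x` and real `U`: "if `W` corresponds to a ground state
then so does `W†`". Lieb, PRL 62 (1989) 1201, proof of Theorem 1. [cite: LiebPRL1989, proof of Theorem 1] -/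
theorem liebOp_conjTranspose (hK : Kᴴ = K) (hL : ∀ x, (L x)ᴴ = L x) (W : Matrix A A ℂ) :
    (liebOp K L U W)ᴴ = liebOp K L U Wᴴ := by
  simp only [liebOp, conjTranspose_add, conjTranspose_mul, conjTranspose_smul,
    conjTranspose_sum, hK, hL, Complex.star_def, Complex.conj_ofReal, Matrix.mul_assoc]
  abel

/-- `𝓗` is self-adjoint for the Hilbert–Schmidt inner product: `⟨Z, 𝓗 W⟩ = ⟨𝓗 Z, W⟩`
(cyclicity of the trace). Lieb, PRL 62 (1989) 1201, eqs. (3)–(4). [cite: LiebPRL1989, eqs. (3)–(4)] -/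
theorem hsInner_liebOp_comm (hK : Kᴴ = K) (hL : ∀ x, (L x)ᴴ = L x) (Z W : Matrix A A ℂ) :
    hsInner Z (liebOp K L U W) = hsInner (liebOp K L U Z) W := by
  simp only [hsInner, liebOp, Matrix.mul_add, Matrix.add_mul, Matrix.mul_smul,
    Matrix.smul_mul, Matrix.mul_sum, Matrix.sum_mul, trace_add, trace_smul, trace_sum,
    conjTranspose_add, conjTranspose_mul, conjTranspose_smul, conjTranspose_sum, hK, hL,
    Complex.star_def, Complex.conj_ofReal]
  congr 1
  · congr 1
    · rw [Matrix.mul_assoc]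
    · rw [← Matrix.mul_assoc, trace_mul_cycle, Matrix.mul_assoc]
  · congr 1
    refine Finset.sum_congr rfl fun x _ => ?_
    rw [show Zᴴ * (L x * W * L x) = Zᴴ * L x * W * L x by simp only [Matrix.mul_assoc],
      trace_mul_comm]
    simp only [Matrix.mul_assoc]

/-- `⟨W, 𝓗 W⟩` is real. Lieb, PRL 62 (1989) 1201, eq. (3). [cite: LiebPRL1989, eq. (3)] -/
theorem hsInner_liebOp_self_im (hK : Kᴴ = K) (hL : ∀ x, (L x)ᴴ = L x) (W : Matrix A A ℂ) :
    (hsInner W (liebOp K L U W)).im = 0 := by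
  have h := star_hsInner W (liebOp K L U W)
  rw [← hsInner_liebOp_comm U hK hL] at h
  exact Complex.conj_eq_iff_im.1 h

/-! ### The variational principle -/

/-- **Variational principle** for the Hilbert–Schmidt-self-adjoint operator `𝓗`: if
`E ‖Z‖² ≤ Re ⟨Z, 𝓗 Z⟩` for every `Z` and `W` saturates the bound, then `𝓗 W = E W` (a minimiser
of the energy functional (3) solves the eigenvalue equation (4); proof: first variation,
`t ↦ ⟨W + tZ, (𝓗 - E)(W + tZ)⟩ ≥ 0`). Lieb, PRL 62 (1989) 1201, eqs. (3)–(4) ("the equation for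
`W`, corresponding to the eigenvalue equation"). [cite: LiebPRL1989, eqs. (3)–(4)] -/
theorem liebOp_eq_smul_of_energy_le (hK : Kᴴ = K) (hL : ∀ x, (L x)ᴴ = L x) {E : ℝ}
    (hE : ∀ Z : Matrix A A ℂ, E * (hsInner Z Z).re ≤ (hsInner Z (liebOp K L U Z)).re)
    {W : Matrix A A ℂ} (hW : (hsInner W (liebOp K L U W)).re ≤ E * (hsInner W W).re) :
    liebOp K L U W = (E : ℂ) • W := by
  -- the shifted operator `T V = 𝓗 V - E V` is self-adjoint and nonnegative
  set T : Matrix A A ℂ → Matrix A A ℂ := fun V => liebOp K L U V - (E : ℂ) • V with hT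
  have hre : ∀ V V' : Matrix A A ℂ, (hsInner V (T V')).re =
      (hsInner V (liebOp K L U V')).re - E * (hsInner V V').re := by
    intro V V'
    simp only [hT, hsInner_sub_right, hsInner_smul_right, Complex.sub_re, Complex.mul_re,
      Complex.ofReal_re, Complex.ofReal_im, zero_mul, sub_zero]
  have hTpos : ∀ V, 0 ≤ (hsInner V (T V)).re := fun V => by rw [hre]; linarith [hE V]
  have hTW : (hsInner W (T W)).re ≤ 0 := by rw [hre]; linarith
  have hTsa : ∀ V V', hsInner V (T V') = hsInner (T V) V' := by
    intro V V'
    simp only [hT, hsInner_sub_right, hsInner_sub_left, hsInner_smul_right, hsInner_smul_left,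
      hsInner_liebOp_comm U hK hL, Complex.star_def, Complex.conj_ofReal]
  have hTadd : ∀ V V', T (V + V') = T V + T V' := by
    intro V V'
    simp only [hT, liebOp_add, smul_add]
    abel
  have hTsmul : ∀ (c : ℂ) (V), T (c • V) = c • T V := by
    intro c V
    simp only [hT, liebOp_smul, smul_sub, smul_comm c (E : ℂ) V]
  set Z := T W with hZ
  have hWTZ : hsInner W (T Z) = hsInner Z Z := by rw [hTsa]
  have hZim : (hsInner Z Z).im = 0 := by
    rw [hsInner_self_eq, Complex.ofReal_im]
  -- expand `Re ⟨W + tZ, T (W + tZ)⟩ = Re ⟨W, T W⟩ + 2 t ‖Z‖² + t² Re ⟨Z, T Z⟩` for real `t`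
  have hexp : ∀ t : ℝ, (hsInner (W + (t : ℂ) • Z) (T (W + (t : ℂ) • Z))).re =
      (hsInner W (T W)).re + 2 * t * (hsInner Z Z).re + t ^ 2 * (hsInner Z (T Z)).re := by
    intro t
    rw [hTadd, hTsmul, hsInner_add_left, hsInner_add_right, hsInner_add_right,
      hsInner_smul_right, hsInner_smul_left, hsInner_smul_left, hsInner_smul_right, hWTZ, ← hZ]
    simp only [Complex.add_re, Complex.mul_re, Complex.star_def, Complex.conj_ofReal,
      Complex.ofReal_re, Complex.ofReal_im, zero_mul, sub_zero, Complex.mul_im, add_zero, hZim,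
      mul_zero]
    ring
  set q := (hsInner Z Z).re with hq
  set c := (hsInner Z (T Z)).re with hc
  have hc0 : 0 ≤ c := hTpos Z
  have key := hTpos (W + ((-q / (c + 1) : ℝ) : ℂ) • Z)
  rw [hexp] at key
  have hq0 : q = 0 := by
    have hc1 : (0 : ℝ) < c + 1 := by linarith
    have h1 : (hsInner W (T W)).re + 2 * (-q / (c + 1)) * q + (-q / (c + 1)) ^ 2 * c =
        (hsInner W (T W)).re - q ^ 2 * (c + 2) / (c + 1) ^ 2 := by
      field_simp
      ring
    rw [h1] at key
    have h3 : q ^ 2 * (c + 2) / (c + 1) ^ 2 ≤ 0 := by linarith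
    rw [div_le_iff₀ (by positivity), zero_mul] at h3
    nlinarith [sq_nonneg q]
  have hZ0 : Z = 0 := (hsInner_self_re_eq_zero_iff Z).1 hq0
  exact sub_eq_zero.1 hZ0

section Spectral

variable [DecidableEq A]

/-- `V diag(f) Vᴴ` for a real vector `f`: with `V` the eigenvector unitary of a Hermitian `W` and
`f` its eigenvalues this is `W`, and with `|f|` it is Lieb's `|W|` ("in an orthonormal basis in which
`W` is diagonal, with diagonal elements `w_i`, `|W|` is also diagonal with elements `|w_i|`").
Lieb, PRL 62 (1989) 1201, proof of Theorem 1. [cite: LiebPRL1989, proof of Theorem 1] -/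
def unitConj (V : Matrix A A ℂ) (f : A → ℝ) : Matrix A A ℂ :=
  V * diagonal (fun a => ((f a : ℝ) : ℂ)) * Vᴴ

omit [Fintype X] in
/-- `V diag(f) Vᴴ` is Hermitian for real `f`. [folklore] -/
theorem unitConj_conjTranspose (V : Matrix A A ℂ) (f : A → ℝ) :
    (unitConj V f)ᴴ = unitConj V f := by
  have hd : (diagonal fun a => ((f a : ℝ) : ℂ))ᴴ = diagonal fun a => ((f a : ℝ) : ℂ) := by
    rw [diagonal_conjTranspose]
    congr 1
    funext a
    simp
  rw [unitConj, conjTranspose_mul, conjTranspose_mul, conjTranspose_conjTranspose, hd,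
    Matrix.mul_assoc]

omit [Fintype X] in
/-- `V diag(f) Vᴴ` is Hermitian for real `f`. [folklore] -/
theorem isHermitian_unitConj (V : Matrix A A ℂ) (f : A → ℝ) : (unitConj V f).IsHermitian :=
  unitConj_conjTranspose V f

omit [Fintype X] in
/-- Functional calculus: `(V D_f Vᴴ)(V D_g Vᴴ) = V D_{fg} Vᴴ` for `Vᴴ V = 1`. [folklore] -/
theorem unitConj_mul_unitConj {V : Matrix A A ℂ} (hV : Vᴴ * V = 1) (f g : A → ℝ) :
    unitConj V f * unitConj V g = unitConj V (f * g) := by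
  simp only [unitConj]
  rw [show V * diagonal (fun a => ((f a : ℝ) : ℂ)) * Vᴴ * (V * diagonal (fun a => ((g a : ℝ) : ℂ)) * Vᴴ)
      = V * diagonal (fun a => ((f a : ℝ) : ℂ)) * (Vᴴ * V) * diagonal (fun a => ((g a : ℝ) : ℂ)) * Vᴴ by
      simp only [Matrix.mul_assoc], hV, Matrix.mul_one, Matrix.mul_assoc V, diagonal_mul_diagonal]
  simp [Matrix.mul_assoc]

omit [Fintype X] in
/-- `V D_{f+g} Vᴴ = V D_f Vᴴ + V D_g Vᴴ`. [folklore] -/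
theorem unitConj_add (V : Matrix A A ℂ) (f g : A → ℝ) :
    unitConj V (f + g) = unitConj V f + unitConj V g := by
  simp only [unitConj, Pi.add_apply, Complex.ofReal_add]
  rw [← Matrix.add_mul, ← Matrix.mul_add, diagonal_add]

omit [Fintype X] in
/-- `V D_{-f} Vᴴ = -V D_f Vᴴ`. [folklore] -/
theorem unitConj_neg (V : Matrix A A ℂ) (f : A → ℝ) : unitConj V (-f) = -unitConj V f := by
  simp only [unitConj, Pi.neg_apply, Complex.ofReal_neg]
  rw [← diagonal_neg, Matrix.mul_neg, Matrix.neg_mul]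

omit [Fintype X] in
/-- `V D_{f-g} Vᴴ = V D_f Vᴴ - V D_g Vᴴ`. [folklore] -/
theorem unitConj_sub (V : Matrix A A ℂ) (f g : A → ℝ) :
    unitConj V (f - g) = unitConj V f - unitConj V g := by
  rw [sub_eq_add_neg, unitConj_add, unitConj_neg, ← sub_eq_add_neg]

omit [Fintype X] in
/-- `V D_{rf} Vᴴ = r V D_f Vᴴ`. [folklore] -/
theorem unitConj_smul (V : Matrix A A ℂ) (r : ℝ) (f : A → ℝ) :
    unitConj V (r • f) = (r : ℂ) • unitConj V f := by
  simp only [unitConj, Pi.smul_apply, smul_eq_mul, Complex.ofReal_mul]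
  rw [show (fun a => (r : ℂ) * (f a : ℂ)) = (r : ℂ) • fun a => ((f a : ℝ) : ℂ) from rfl,
    diagonal_smul, Matrix.mul_smul, Matrix.smul_mul]

omit [Fintype X] in
/-- `‖V D_f Vᴴ‖²_HS = Σ f²` (`Vᴴ V = 1`). [folklore] -/
theorem hsInner_unitConj_self {V : Matrix A A ℂ} (hV : Vᴴ * V = 1) (f : A → ℝ) :
    hsInner (unitConj V f) (unitConj V f) = ((∑ a, f a ^ 2 : ℝ) : ℂ) := by
  rw [hsInner, unitConj_conjTranspose, unitConj_mul_unitConj hV, unitConj, trace_mul_comm,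
    ← Matrix.mul_assoc, hV, Matrix.one_mul, trace_diagonal]
  push_cast
  exact Finset.sum_congr rfl fun a _ => by simp [sq]

omit [Fintype X] in
/-- `Tr |W|² = Tr W²`: `|W|` and `W` have the same Hilbert–Schmidt norm.
Lieb, PRL 62 (1989) 1201, proof of Theorem 1 ("Obviously, `Tr W² = Tr |W|²`"). [cite: LiebPRL1989, proof of Theorem 1] -/
theorem hsInner_unitConj_abs_self {V : Matrix A A ℂ} (hV : Vᴴ * V = 1) (f : A → ℝ) :
    hsInner (unitConj V |f|) (unitConj V |f|) = hsInner (unitConj V f) (unitConj V f) := by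
  rw [hsInner_unitConj_self hV, hsInner_unitConj_self hV]
  simp

omit [Fintype X] in
/-- `|W|² = W²`. Lieb, PRL 62 (1989) 1201, proof of Theorem 1 ("the positive semidefinite matrix
`|W|` defined by `|W|² = W²`"). [cite: LiebPRL1989, proof of Theorem 1] -/
theorem unitConj_abs_mul_self (V : Matrix A A ℂ) {hV : Vᴴ * V = 1} (f : A → ℝ) :
    unitConj V |f| * unitConj V |f| = unitConj V f * unitConj V f := by
  rw [unitConj_mul_unitConj hV, unitConj_mul_unitConj hV]
  congr 1
  funext a
  simp

omit [Fintype X] in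
/-- `tr (V D_f Vᴴ M V D_g Vᴴ M') = tr (D_f (Vᴴ M V) D_g (Vᴴ M' V))` (computing in the diagonal
basis). Lieb, PRL 62 (1989) 1201, proof of Theorem 1 ("In this diagonal basis I compute"). [cite: LiebPRL1989, proof of Theorem 1] -/
theorem trace_unitConj_mul_mul (V : Matrix A A ℂ) (f g : A → ℝ) (M M' : Matrix A A ℂ) :
    (unitConj V f * M * unitConj V g * M').trace =
      (diagonal (fun a => ((f a : ℝ) : ℂ)) * (Vᴴ * M * V) *
        diagonal (fun a => ((g a : ℝ) : ℂ)) * (Vᴴ * M' * V)).trace := by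
  simp only [unitConj, Matrix.mul_assoc]
  rw [trace_mul_comm]
  simp only [Matrix.mul_assoc]

omit [Fintype X] in
/-- `tr (D N D' N') = Σ_{a,b} d_a N_{ab} d'_b N'_{ba}`. [folklore] -/
theorem trace_diagonal_mul_mul_diagonal_mul (d d' : A → ℂ) (N N' : Matrix A A ℂ) :
    (diagonal d * N * diagonal d' * N').trace = ∑ a, ∑ b, d a * N a b * d' b * N' b a := by
  unfold Matrix.trace Matrix.diag
  refine Finset.sum_congr rfl fun a _ => ?_
  rw [Matrix.mul_apply]
  refine Finset.sum_congr rfl fun b _ => ?_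
  rw [mul_diagonal, diagonal_mul]

omit [Fintype X] in
/-- **Lieb's trace inequality**: for Hermitian `M`,
`Tr W M W M = Σ_{i,j} w_i w_j |M_{ij}|² ≤ Σ_{i,j} |w_i| |w_j| |M_{ij}|² = Tr |W| M |W| M`, where
`W = V D_w Vᴴ`, `|W| = V D_{|w|} Vᴴ`. Lieb, PRL 62 (1989) 1201, proof of Theorem 1 (displayed
inequality after eq. (4)). [cite: LiebPRL1989, proof of Theorem 1] -/
theorem re_trace_unitConj_mul_le (V : Matrix A A ℂ) (f : A → ℝ) {M : Matrix A A ℂ}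
    (hM : Mᴴ = M) :
    ((unitConj V f * M * unitConj V f * M).trace).re ≤
      ((unitConj V |f| * M * unitConj V |f| * M).trace).re := by
  set N := Vᴴ * M * V with hN
  have hNh : ∀ a b, N b a = star (N a b) := by
    intro a b
    have : Nᴴ = N := by
      rw [hN, conjTranspose_mul, conjTranspose_mul, conjTranspose_conjTranspose, hM,
        Matrix.mul_assoc]
    conv_lhs => rw [← this]
    rfl
  have key : ∀ g : A → ℝ, ((unitConj V g * M * unitConj V g * M).trace).re =
      ∑ a, ∑ b, g a * g b * ‖N a b‖ ^ 2 := by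
    intro g
    rw [trace_unitConj_mul_mul, ← hN, trace_diagonal_mul_mul_diagonal_mul, Complex.re_sum]
    refine Finset.sum_congr rfl fun a _ => ?_
    rw [Complex.re_sum]
    refine Finset.sum_congr rfl fun b _ => ?_
    rw [hNh a b, Complex.star_def, show (g a : ℂ) * N a b * (g b : ℂ) * (starRingEnd ℂ) (N a b)
      = (g a : ℂ) * (g b : ℂ) * (N a b * (starRingEnd ℂ) (N a b)) by ring, Complex.mul_conj']
    norm_cast
  rw [key, key]
  refine Finset.sum_le_sum fun a _ => Finset.sum_le_sum fun b _ => ?_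
  refine mul_le_mul_of_nonneg_right ?_ (sq_nonneg _)
  rw [Pi.abs_apply, Pi.abs_apply, ← abs_mul]
  exact le_abs_self _

end Spectral

/-! ### Lieb's argument -/

section Core

variable [DecidableEq A]
variable {K : Matrix A A ℂ} {L : X → Matrix A A ℂ} {U E : ℝ}

/-- The standing hypotheses of Lieb's matrix argument for Theorem 1(b): `K` and the `L_x`
Hermitian (in the paper: real symmetric), strictly attractive coupling `U < 0`, `E` a lower bound
of the quadratic form of `𝓗` on all matrices (in the application `E` is the ground-state energy,
so solutions of `𝓗 W = E W` are exactly the ground states), and irreducibility: no proper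
nonzero subspace of `ℂ^A` is invariant under `K` and all the `L_x` (in the paper this is derived
from the connectivity of `Λ`; here it is a hypothesis, discharged for the Hubbard model in
`HubbardWave0LiebProofs`). Lieb, PRL 62 (1989) 1201, Theorem 1(b) and its proof. [cite: LiebPRL1989, Theorem 1] -/
structure IsLiebSystem (K : Matrix A A ℂ) (L : X → Matrix A A ℂ) (U E : ℝ) : Prop where
  /-- `K` is Hermitian (Lieb: real symmetric). -/
  K_herm : Kᴴ = K
  /-- Every `L_x` is Hermitian (Lieb: real symmetric). -/
  L_herm : ∀ x, (L x)ᴴ = L x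
  /-- The coupling is strictly attractive. -/
  U_neg : U < 0
  /-- `E` bounds the energy functional from below: `E ‖Z‖² ≤ Re ⟨Z, 𝓗 Z⟩` for all `Z`. -/
  energy_le : ∀ Z : Matrix A A ℂ, E * (hsInner Z Z).re ≤ (hsInner Z (liebOp K L U Z)).re
  /-- Irreducibility: a subspace invariant under `K` and all `L_x` is trivial. -/
  irred : ∀ Q : Submodule ℂ (A → ℂ), (∀ v ∈ Q, K *ᵥ v ∈ Q) → (∀ x, ∀ v ∈ Q, L x *ᵥ v ∈ Q) →
    Q = ⊥ ∨ Q = ⊤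

omit [DecidableEq A] in
/-- A solution of `𝓗 W = E W` has energy `E(W) = E ‖W‖²`. Lieb, PRL 62 (1989) 1201, eqs. (3)–(4). [cite: LiebPRL1989, eqs. (3)–(4)] -/
theorem re_hsInner_of_liebOp_eq_smul {W : Matrix A A ℂ} (hW : liebOp K L U W = (E : ℂ) • W) :
    (hsInner W (liebOp K L U W)).re = E * (hsInner W W).re := by
  rw [hW, hsInner_smul_right, Complex.re_ofReal_mul]

omit [DecidableEq A] in
/-- Lieb's energy functional on Hermitian matrices:
`E(W) = ⟨W, 𝓗 W⟩ = 2 Tr K W² + U Σ_x Tr (W L_x W L_x)`. Lieb, PRL 62 (1989) 1201, eq. (3). [cite: LiebPRL1989, eq. (3)] -/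
theorem hsInner_liebOp_of_conjTranspose_eq {W : Matrix A A ℂ} (hW : Wᴴ = W) :
    hsInner W (liebOp K L U W) =
      2 * (K * (W * W)).trace + (U : ℂ) * ∑ x, (W * L x * W * L x).trace := by
  rw [hsInner, hW, liebOp, Matrix.mul_add, Matrix.mul_add, trace_add, trace_add, Matrix.mul_smul,
    trace_smul, Matrix.mul_sum, trace_sum, smul_eq_mul, two_mul]
  congr 1
  · congr 1
    · rw [trace_mul_comm, Matrix.mul_assoc]
    · rw [trace_mul_cycle']
  · congr 1
    exact Finset.sum_congr rfl fun x _ => by simp only [Matrix.mul_assoc]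

omit [DecidableEq A] in
/-- If `W` solves (4) then so does `Wᴴ` ("if `W_{αβ}` corresponds to a ground state then so does
`(W†)_{αβ}`"). Lieb, PRL 62 (1989) 1201, proof of Theorem 1. [cite: LiebPRL1989, proof of Theorem 1] -/
theorem liebOp_conjTranspose_eq_smul (hK : Kᴴ = K) (hL : ∀ x, (L x)ᴴ = L x) {W : Matrix A A ℂ}
    (hW : liebOp K L U W = (E : ℂ) • W) : liebOp K L U Wᴴ = (E : ℂ) • Wᴴ := by
  rw [← liebOp_conjTranspose U hK hL, hW, conjTranspose_smul, Complex.star_def,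
    Complex.conj_ofReal]

/-- **Spin-space reflection positivity.** If the Hermitian `W = V D_w Vᴴ` solves (4) at the
minimal energy `E`, so does `|W| = V D_{|w|} Vᴴ`: `E(|W|) ≤ E(W)` by the trace inequality and
`U < 0`, while `‖|W|‖ = ‖W‖`, so `|W|` saturates the variational bound ("Since `U_x ≤ 0`, I conclude
that `E(W) ≥ E(|W|)` and therefore that among the ground states there is one satisfying
`W = |W|`"). Lieb, PRL 62 (1989) 1201, proof of Theorem 1. [cite: LiebPRL1989, proof of Theorem 1] -/
theorem IsLiebSystem.liebOp_unitConj_abs (h : IsLiebSystem K L U E) {V : Matrix A A ℂ}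
    (hV : Vᴴ * V = 1) (f : A → ℝ)
    (hW : liebOp K L U (unitConj V f) = (E : ℂ) • unitConj V f) :
    liebOp K L U (unitConj V |f|) = (E : ℂ) • unitConj V |f| := by
  apply liebOp_eq_smul_of_energy_le U h.K_herm h.L_herm h.energy_le
  have e1 := hsInner_unitConj_abs_self hV f
  have e3 := re_hsInner_of_liebOp_eq_smul hW
  have e2 : (hsInner (unitConj V |f|) (liebOp K L U (unitConj V |f|))).re ≤
      (hsInner (unitConj V f) (liebOp K L U (unitConj V f))).re := by
    rw [hsInner_liebOp_of_conjTranspose_eq (unitConj_conjTranspose V |f|),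
      hsInner_liebOp_of_conjTranspose_eq (unitConj_conjTranspose V f),
      unitConj_abs_mul_self V (hV := hV) f]
    simp only [Complex.add_re, Complex.re_ofReal_mul, Complex.re_sum, add_le_add_iff_left]
    refine mul_le_mul_of_nonpos_left (Finset.sum_le_sum fun x _ => ?_) h.U_neg.le
    exact re_trace_unitConj_mul_le V f (h.L_herm x)
  rw [e1]
  exact e2.trans_eq e3

omit [DecidableEq A] in
/-- `𝓗 W` applied to a vector. Lieb, PRL 62 (1989) 1201, eq. (4) ("let the matrices in (4) act
on `V`"). [cite: LiebPRL1989, eq. (4)] -/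
theorem liebOp_mulVec (W : Matrix A A ℂ) (v : A → ℂ) :
    liebOp K L U W *ᵥ v =
      K *ᵥ (W *ᵥ v) + W *ᵥ (K *ᵥ v) + (U : ℂ) • ∑ x, L x *ᵥ (W *ᵥ (L x *ᵥ v)) := by
  simp only [liebOp, add_mulVec, smul_mulVec, sum_mulVec, ← mulVec_mulVec]

omit [DecidableEq A] in
/-- `⟨v, M w⟩ = ⟨M v, w⟩` for Hermitian `M`. [folklore] -/
theorem star_dotProduct_mulVec_of_conjTranspose_eq {M : Matrix A A ℂ} (hM : Mᴴ = M)
    (v w : A → ℂ) : star v ⬝ᵥ (M *ᵥ w) = star (M *ᵥ v) ⬝ᵥ w := by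
  rw [dotProduct_mulVec, star_mulVec, hM]

/-- **Kernel step.** A positive semidefinite solution `R` of (4) is `0` or positive definite:
its kernel `Q` is invariant under every `L_x` (take the expectation of (4) in `V ∈ Q`: `U < 0`
and `⟨V|L_x R L_x|V⟩ ≥ 0` force `R L_x V = 0`) and under `K` (then `R K V = 0` from (4)), hence
`Q = 0` or everything by irreducibility. Lieb, PRL 62 (1989) 1201, proof of Theorem 1
("Q is either just the zero vector or else every vector is in Q"). [cite: LiebPRL1989, proof of Theorem 1] -/
theorem IsLiebSystem.eq_zero_or_posDef (h : IsLiebSystem K L U E) {R : Matrix A A ℂ}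
    (hR : R.PosSemidef) (hgs : liebOp K L U R = (E : ℂ) • R) : R = 0 ∨ R.PosDef := by
  set Q : Submodule ℂ (A → ℂ) := LinearMap.ker (Matrix.toLin' R) with hQ
  have hmem : ∀ v, v ∈ Q ↔ R *ᵥ v = 0 := fun v => by
    rw [hQ, LinearMap.mem_ker, Matrix.toLin'_apply]
  -- invariance under the `L x`
  have hL : ∀ x, ∀ v ∈ Q, L x *ᵥ v ∈ Q := by
    intro x v hv
    rw [hmem] at hv ⊢
    have h1 : liebOp K L U R *ᵥ v = 0 := by rw [hgs, smul_mulVec, hv, smul_zero]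
    rw [liebOp_mulVec, hv, mulVec_zero, zero_add] at h1
    have h2 := congrArg (fun w => star v ⬝ᵥ w) h1
    simp only [dotProduct_add, dotProduct_zero, dotProduct_smul, dotProduct_sum,
      star_dotProduct_mulVec_of_conjTranspose_eq hR.1.eq v, hv, star_zero, zero_dotProduct,
      zero_add, smul_eq_mul, mul_eq_zero, Complex.ofReal_eq_zero, h.U_neg.ne, false_or] at h2
    have h3 : ∀ y ∈ (univ : Finset X), 0 ≤ star v ⬝ᵥ (L y *ᵥ (R *ᵥ (L y *ᵥ v))) := by
      intro y _
      rw [star_dotProduct_mulVec_of_conjTranspose_eq (h.L_herm y)]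
      exact hR.dotProduct_mulVec_nonneg _
    have h4 := (Finset.sum_eq_zero_iff_of_nonneg h3).1 h2 x (mem_univ x)
    rw [star_dotProduct_mulVec_of_conjTranspose_eq (h.L_herm x)] at h4
    exact (hR.dotProduct_mulVec_zero_iff _).1 h4
  -- invariance under `K`
  have hK : ∀ v ∈ Q, K *ᵥ v ∈ Q := by
    intro v hv
    have hLv : ∀ x, R *ᵥ (L x *ᵥ v) = 0 := fun x => (hmem _).1 (hL x v hv)
    rw [hmem] at hv ⊢
    have h1 : liebOp K L U R *ᵥ v = 0 := by rw [hgs, smul_mulVec, hv, smul_zero]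
    rw [liebOp_mulVec, hv, mulVec_zero, zero_add] at h1
    simpa [hLv] using h1
  rcases h.irred Q hK hL with hbot | htop
  · right
    refine PosDef.of_dotProduct_mulVec_pos hR.1 fun v hv => ?_
    refine lt_of_le_of_ne (hR.dotProduct_mulVec_nonneg v) fun h0 => hv ?_
    have : v ∈ Q := (hmem v).2 ((hR.dotProduct_mulVec_zero_iff v).1 h0.symm)
    rwa [hbot, Submodule.mem_bot] at this
  · left
    have : Matrix.toLin' R = 0 := LinearMap.ker_eq_top.1 (hQ ▸ htop)
    exact Matrix.toLin'.map_eq_zero_iff.1 this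

omit [Fintype X] in
/-- `V D_f Vᴴ ≥ 0` for `f ≥ 0`. [folklore] -/
theorem posSemidef_unitConj (V : Matrix A A ℂ) {f : A → ℝ} (hf : ∀ a, 0 ≤ f a) :
    (unitConj V f).PosSemidef :=
  PosSemidef.mul_mul_conjTranspose_same
    (posSemidef_diagonal_iff.2 fun a => Complex.zero_le_real.2 (hf a)) V

omit [Fintype X] in
/-- For invertible `V`, `V D_f Vᴴ` is positive definite iff `f > 0`. [folklore] -/
theorem posDef_unitConj_iff {V : Matrix A A ℂ} (hV : IsUnit V) (f : A → ℝ) :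
    (unitConj V f).PosDef ↔ ∀ a, 0 < f a := by
  rw [unitConj, ← star_eq_conjTranspose, Matrix.IsUnit.posDef_star_right_conjugate_iff hV,
    posDef_diagonal_iff]
  exact forall_congr' fun a => Complex.zero_lt_real

/-- **`W = ±|W|`.** A Hermitian solution of (4) is `0`, positive definite or negative definite:
apply the kernel step to the positive semidefinite solution `R = |W| - W`.
Lieb, PRL 62 (1989) 1201, proof of Theorem 1 ("necessarily a Hermitian `W` satisfies `W = |W|` or
`W = -|W|` for every ground state when `U_x < 0`"). [cite: LiebPRL1989, proof of Theorem 1] -/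
theorem IsLiebSystem.trichotomy (h : IsLiebSystem K L U E) {W : Matrix A A ℂ}
    (hW : W.IsHermitian) (hgs : liebOp K L U W = (E : ℂ) • W) :
    W = 0 ∨ W.PosDef ∨ (-W).PosDef := by
  set V : Matrix A A ℂ := (hW.eigenvectorUnitary : Matrix A A ℂ) with hVdef
  set f : A → ℝ := hW.eigenvalues with hf
  have hVu : IsUnit V := ⟨Unitary.toUnits hW.eigenvectorUnitary, rfl⟩
  have hV : Vᴴ * V = 1 := by
    rw [← star_eq_conjTranspose]
    exact Unitary.coe_star_mul_self hW.eigenvectorUnitary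
  have hWeq : W = unitConj V f := by
    conv_lhs => rw [hW.spectral_theorem]
    rw [Unitary.conjStarAlgAut_apply, star_eq_conjTranspose]
    rfl
  rw [hWeq] at hgs ⊢
  have habs := h.liebOp_unitConj_abs hV f hgs
  -- `R = |W| - W ≥ 0` solves (4)
  have hRgs : liebOp K L U (unitConj V (|f| - f)) = (E : ℂ) • unitConj V (|f| - f) := by
    rw [unitConj_sub, liebOp_sub, habs, hgs, smul_sub]
  have hRpsd : (unitConj V (|f| - f)).PosSemidef :=
    posSemidef_unitConj V fun a => by
      rw [Pi.sub_apply, Pi.abs_apply, sub_nonneg]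
      exact le_abs_self _
  rcases h.eq_zero_or_posDef hRpsd hRgs with hR0 | hRpd
  · -- `W = |W| ≥ 0`
    rw [unitConj_sub, sub_eq_zero] at hR0
    have hWpsd : (unitConj V f).PosSemidef := hR0 ▸ posSemidef_unitConj V fun a => abs_nonneg _
    rcases h.eq_zero_or_posDef hWpsd hgs with h0 | hpd
    · exact Or.inl h0
    · exact Or.inr (Or.inl hpd)
  · -- `|W| - W > 0` forces all eigenvalues `< 0`
    right; right
    rw [← unitConj_neg, posDef_unitConj_iff hVu]
    rw [posDef_unitConj_iff hVu] at hRpd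
    intro a
    have := hRpd a
    simp only [Pi.sub_apply, Pi.abs_apply, sub_pos] at this
    simp only [Pi.neg_apply, Left.neg_pos_iff]
    by_contra hle
    exact (lt_irrefl _) (this.trans_le (abs_of_nonneg (not_lt.1 hle)).le)

/-- A nonzero Hermitian solution of (4) is `± P` with `P` a positive definite solution.
Lieb, PRL 62 (1989) 1201, proof of Theorem 1. [cite: LiebPRL1989, proof of Theorem 1] -/
theorem IsLiebSystem.exists_posDef_of_isHermitian (h : IsLiebSystem K L U E) {W : Matrix A A ℂ}
    (hW : W.IsHermitian) (hgs : liebOp K L U W = (E : ℂ) • W) (hW0 : W ≠ 0) :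
    ∃ P : Matrix A A ℂ, P.PosDef ∧ liebOp K L U P = (E : ℂ) • P ∧ (W = P ∨ W = -P) := by
  rcases h.trichotomy hW hgs with h0 | hpd | hnd
  · exact absurd h0 hW0
  · exact ⟨W, hpd, hgs, Or.inl rfl⟩
  · exact ⟨-W, hnd, by rw [liebOp_neg, hgs, smul_neg], Or.inr (neg_neg W).symm⟩

/-- **Proportionality.** A Hermitian solution `W` of (4) is a real multiple of any positive
definite solution `P`: with `d` an eigenvalue of `P⁻¹ W` (real, since `⟨v, W v⟩ = d ⟨v, P v⟩`),
`W - d P` is a singular Hermitian solution, hence `0` by the trichotomy. This replaces Lieb's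
"it is easy to verify that there must be a `d` for which `W_d = W¹ + d W²` is neither positive nor
negative semidefinite". Lieb, PRL 62 (1989) 1201, proof of Theorem 1. [cite: LiebPRL1989, proof of Theorem 1] -/
theorem IsLiebSystem.exists_eq_real_smul (h : IsLiebSystem K L U E) {P W : Matrix A A ℂ}
    (hP : P.PosDef) (hPgs : liebOp K L U P = (E : ℂ) • P) (hW : W.IsHermitian)
    (hWgs : liebOp K L U W = (E : ℂ) • W) : ∃ r : ℝ, W = (r : ℂ) • P := by
  cases isEmpty_or_nonempty A
  · exact ⟨0, Subsingleton.elim _ _⟩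
  -- an eigenvector of `P⁻¹ W`
  obtain ⟨c, hc⟩ := Module.End.exists_eigenvalue (Matrix.toLin' (P⁻¹ * W))
  obtain ⟨v, hv⟩ := hc.exists_hasEigenvector
  have hv0 : v ≠ 0 := hv.2
  have hWv : W *ᵥ v = c • (P *ᵥ v) := by
    have h1 : (P⁻¹ * W) *ᵥ v = c • v := by rw [← Matrix.toLin'_apply]; exact hv.apply_eq_smul
    have hPdet : IsUnit P.det := (Matrix.isUnit_iff_isUnit_det P).1 hP.isUnit
    calc W *ᵥ v = (P * (P⁻¹ * W)) *ᵥ v := by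
          rw [← Matrix.mul_assoc, Matrix.mul_nonsing_inv P hPdet, Matrix.one_mul]
      _ = c • (P *ᵥ v) := by rw [← mulVec_mulVec, h1, mulVec_smul]
  -- `c` is real: `⟨v, W v⟩ = c ⟨v, P v⟩` with `⟨v, P v⟩ > 0`
  have hp : 0 < star v ⬝ᵥ (P *ᵥ v) := hP.dotProduct_mulVec_pos hv0
  have hwim : (star v ⬝ᵥ (W *ᵥ v)).im = 0 := hW.im_star_dotProduct_mulVec_self v
  have hcim : c.im = 0 := by
    have h1 : star v ⬝ᵥ (W *ᵥ v) = c * (star v ⬝ᵥ (P *ᵥ v)) := by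
      rw [hWv, dotProduct_smul, smul_eq_mul]
    obtain ⟨hpre, hpim⟩ := Complex.pos_iff.1 hp
    have h2 := congrArg Complex.im h1
    rw [hwim, Complex.mul_im, ← hpim, mul_zero, zero_add] at h2
    exact (mul_eq_zero.1 h2.symm).resolve_right hpre.ne'
  refine ⟨c.re, ?_⟩
  have hc_eq : (c.re : ℂ) = c := Complex.ext rfl (by simp [hcim])
  rw [hc_eq]
  -- `Z = W - c P` is a Hermitian solution with `Z v = 0`
  have hZh : (W - c • P).IsHermitian := by
    rw [IsHermitian, conjTranspose_sub, conjTranspose_smul, hW.eq, hP.1.eq, ← hc_eq,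
      Complex.star_def, Complex.conj_ofReal]
  have hZgs : liebOp K L U (W - c • P) = (E : ℂ) • (W - c • P) := by
    rw [liebOp_sub, liebOp_smul, hWgs, hPgs, smul_sub, smul_comm]
  have hZv : (W - c • P) *ᵥ v = 0 := by rw [sub_mulVec, smul_mulVec, hWv, sub_self]
  rcases h.trichotomy hZh hZgs with h0 | hpd | hnd
  · exact sub_eq_zero.1 h0
  · exact absurd (hZv ▸ hpd.dotProduct_mulVec_pos hv0) (by simp)
  · have : (-(W - c • P)) *ᵥ v = 0 := by rw [neg_mulVec, hZv, neg_zero]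
    exact absurd (this ▸ hnd.dotProduct_mulVec_pos hv0) (by simp)

/-- Every nonzero solution `W` of (4) is a complex multiple of a positive definite solution:
`W = ½ (X + iY)` with `X = W + Wᴴ`, `Y = i(Wᴴ - W)` Hermitian solutions ("hence (by linearity) so
does `W + W†` and `i(W - W†)`"), both real multiples of one positive definite solution.
Lieb, PRL 62 (1989) 1201, proof of Theorem 1. [cite: LiebPRL1989, proof of Theorem 1] -/
theorem IsLiebSystem.exists_posDef_eq_smul (h : IsLiebSystem K L U E) {W : Matrix A A ℂ}
    (hgs : liebOp K L U W = (E : ℂ) • W) (hW0 : W ≠ 0) :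
    ∃ P : Matrix A A ℂ, P.PosDef ∧ liebOp K L U P = (E : ℂ) • P ∧ ∃ c : ℂ, W = c • P := by
  have hgs' := liebOp_conjTranspose_eq_smul h.K_herm h.L_herm hgs
  -- Hermitian and anti-Hermitian parts
  set X := W + Wᴴ with hX
  set Y := Complex.I • (Wᴴ - W) with hY
  have hXh : X.IsHermitian := by
    rw [IsHermitian, hX, conjTranspose_add, conjTranspose_conjTranspose, add_comm]
  have hYh : Y.IsHermitian := by
    rw [IsHermitian, hY, conjTranspose_smul, conjTranspose_sub, conjTranspose_conjTranspose,
      Complex.star_def, Complex.conj_I, neg_smul, ← smul_neg, neg_sub]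
  have hXgs : liebOp K L U X = (E : ℂ) • X := by rw [hX, liebOp_add, hgs, hgs', smul_add]
  have hYgs : liebOp K L U Y = (E : ℂ) • Y := by
    rw [hY, liebOp_smul, liebOp_sub, hgs, hgs', ← smul_sub, smul_comm]
  have hWXY : W = (1 / 2 : ℂ) • (X + Complex.I • Y) := by
    rw [hX, hY, smul_smul, Complex.I_mul_I, neg_one_smul, neg_sub,
      show W + Wᴴ + (W - Wᴴ) = (2 : ℂ) • W by rw [two_smul]; abel, smul_smul]
    norm_num
  -- a nonzero Hermitian solution among `X`, `Y`, hence a positive definite one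
  obtain ⟨Z, hZh, hZgs, hZ0⟩ : ∃ Z : Matrix A A ℂ, Z.IsHermitian ∧
      liebOp K L U Z = (E : ℂ) • Z ∧ Z ≠ 0 := by
    by_cases hX0 : X = 0
    · refine ⟨Y, hYh, hYgs, fun hY0 => hW0 ?_⟩
      rw [hWXY, hX0, hY0, smul_zero, add_zero, smul_zero]
    · exact ⟨X, hXh, hXgs, hX0⟩
  obtain ⟨P, hP, hPgs, -⟩ := h.exists_posDef_of_isHermitian hZh hZgs hZ0
  obtain ⟨a, ha⟩ := h.exists_eq_real_smul hP hPgs hXh hXgs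
  obtain ⟨b, hb⟩ := h.exists_eq_real_smul hP hPgs hYh hYgs
  refine ⟨P, hP, hPgs, (1 / 2 : ℂ) * (a + Complex.I * b), ?_⟩
  rw [hWXY, ha, hb, smul_smul, ← add_smul, smul_smul]

/-- **Lieb's uniqueness theorem, matrix form.** Under `IsLiebSystem K L U E`, any two solutions
of `𝓗 W = E W`, the first nonzero, are proportional ("which, in turn, implies uniqueness of the
ground state"). Lieb, PRL 62 (1989) 1201, Theorem 1(b) and its proof. [cite: LiebPRL1989, Theorem 1] -/
theorem IsLiebSystem.exists_eq_smul (h : IsLiebSystem K L U E) {W₁ W₂ : Matrix A A ℂ}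
    (h₁ : liebOp K L U W₁ = (E : ℂ) • W₁) (h₂ : liebOp K L U W₂ = (E : ℂ) • W₂) (hW₁ : W₁ ≠ 0) :
    ∃ c : ℂ, W₂ = c • W₁ := by
  obtain ⟨P, hP, hPgs, c₁, hc₁⟩ := h.exists_posDef_eq_smul h₁ hW₁
  have hc₁0 : c₁ ≠ 0 := by
    rintro rfl
    exact hW₁ (by rw [hc₁, zero_smul])
  by_cases hW₂ : W₂ = 0
  · exact ⟨0, by rw [hW₂, zero_smul]⟩
  obtain ⟨P₂, hP₂, hP₂gs, c₂, hc₂⟩ := h.exists_posDef_eq_smul h₂ hW₂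
  obtain ⟨r, hr⟩ := h.exists_eq_real_smul hP hPgs hP₂.1 hP₂gs
  refine ⟨c₂ * r * c₁⁻¹, ?_⟩
  rw [hc₂, hr, hc₁, smul_smul, smul_smul, mul_assoc, inv_mul_cancel₀ hc₁0, mul_one]

/-- **Nonvanishing diagonal.** A nonzero solution of `𝓗 W = E W` is a nonzero multiple of a
positive definite matrix, so all its diagonal entries `W_{αα}` are nonzero ("Since `W ≥ 0`, it
follows that `W_{αα} > 0` for at least one `α`"; with uniqueness, for all `α`), which gives the
nonzero overlap with the `S = 0` states `ψ^α_↑ ⊗ ψ^α_↓`. Lieb, PRL 62 (1989) 1201, proof of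
Theorem 1. [cite: LiebPRL1989, proof of Theorem 1] -/
theorem IsLiebSystem.apply_self_ne_zero (h : IsLiebSystem K L U E) {W : Matrix A A ℂ}
    (hgs : liebOp K L U W = (E : ℂ) • W) (hW0 : W ≠ 0) (a : A) : W a a ≠ 0 := by
  obtain ⟨P, hP, -, c, hc⟩ := h.exists_posDef_eq_smul hgs hW0
  have hc0 : c ≠ 0 := by
    rintro rfl
    exact hW0 (by rw [hc, zero_smul])
  rw [hc, Matrix.smul_apply, smul_eq_mul]
  exact mul_ne_zero hc0 (hP.diag_pos (i := a)).ne'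

end Core

end LiebMatrix

end Literature.MathematicalPhysics.QuantumLattice
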